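import Summits.Ventures.YMGap.Conjectures.StrongCouplingSUNChiralLROMesonWeightBeta
import HarnessLib
import HarnessLib.Audit.Tags

/-!
# Lattice symmetries of the `β`-dressed `SU(N)` meson moments (all-antiperiodic boundary condition):
# the Wilson action under coordinate permutations, translations, axis transpositions, chiral grading

Cell `pub-ymgap`, seat qcd-lit g26 (literature-prover), `bears_on: Q1` (what the `SU(N)` extension of
Salmhofer–Seiler §5 p. 424 needs at `β > 0`).  Everything is a theorem (0 facts, 0 sorry).  The `β ≥ 0` twin of
`…SUNChiralLROMesonWeightSymmetry`, with the plaquette weight carried along: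

* THE WILSON ACTION OF ANY UNITARY REPRESENTATION IS INVARIANT UNDER COORDINATE PERMUTATIONS
  (`wilsonActionG_configPerm`; `configPermG σ = U ∘ (edgePerm σ)⁻¹` for a general gauge group — the `U(N)`
  computation of `…MesonWeightAxisPermutationGauge` verbatim for `repMat ρ`), hence `plaqSU_configPerm`; and it
  is translation invariant (`plaqSU_torusConfigShift`, the tree's `wilsonAction_torusConfigShift`).
* `J_β(ρ_{g,s}G) = det ρ · J_β(G)` for relabellings compatible with the links, the all-antiperiodic signs and
  the plaquette weight (`suJB_siteRelabel`); `det ρ = 1` given `Z_β ≠ 0`; so the `β`-dressed moments are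
  invariant under translations (`mesonMomentSUB_mapDomain_addRight`, slab sign flips of `…Symmetry`) and
  axis transpositions (`mesonMomentSUB_mapDomain_axisSwap`).
* The chiral grading at `β` (`suTwoPointB_eq_zero_of_sgn_eq`).

Honest framing: finite even torus, every real `β`, `Z_β ≠ 0` a hypothesis; nothing about the thermodynamic
or continuum limit or the summit's `QCD` conjunct.

## References
* [MontvayMunster1994] I. Montvay, G. Münster, *Quantum Fields on a Lattice*, CUP 1994, §3.2, §4.3 (4.186)–(4.190).
* [SalmhoferSeiler1991] M. Salmhofer, E. Seiler, Commun. Math. Phys. 139 (1991) 395–432, §2 (2.2)–(2.4),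
  (2.9)–(2.12), (3.100)–(3.101), (3.106), §5 p. 424.
* [Berezin1966] F. A. Berezin, *The Method of Second Quantization*, 1966, Ch. I §3.
-/

noncomputable section

open MeasureTheory Finset MvPolynomial
open scoped ComplexConjugate BigOperators ComplexOrder
open Literature.MathematicalPhysics.QuantumFieldTheory (Site Edge GaugeConfig wilsonAction plaquetteHolonomy
  torusEdgeShift torusEdgeShift_apply torusConfigShift wilsonAction_torusConfigShift)
open Literature.MathematicalPhysics.QuantumFieldTheory.WilsonRP
open Literature.MathematicalPhysics.QuantumLattice
open Literature.MathematicalPhysics.QuantumLattice.GrassmannAlgebra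
open Literature.MathematicalPhysics.QuantumLattice.StrongCoupling
open Literature.MathematicalPhysics.QuantumLattice.StaggeredShift (shiftSign phase_add_eq_shiftSign_mul cast_shiftSign_mul_self)
open Literature.MathematicalPhysics.StatisticalMechanics
open Literature.MathematicalPhysics.StatisticalMechanics.ComplexSpin
open Literature.Probability.LatticeModels (TorusSite)

namespace Summit.Ventures.YMGap.Conjectures

namespace MesonWeightSU

open MesonWeight SchwingerDyson

/-! ### Coordinate permutations of gauge fields for a general gauge group; the Wilson action is invariant -/

section GaugePerm

variable {N ν L : ℕ} {G : Type*} [MeasurableSpace G]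

/-- The action of an axis permutation on `G`-valued gauge fields, `U ↦ U ∘ (edgePerm σ)⁻¹`. [cite: MontvayMunster1994, §3.2] -/
def configPermG (σ : Equiv.Perm (Fin ν)) : GaugeConfig ν L G ≃ᵐ GaugeConfig ν L G :=
  MeasurableEquiv.arrowCongr' (edgePerm σ) (MeasurableEquiv.refl G)

/-- `configPermG` pointwise. [cite: MontvayMunster1994, §3.2] -/
theorem configPermG_apply (σ : Equiv.Perm (Fin ν)) (U : GaugeConfig ν L G) (e : Edge ν L) :
    configPermG σ U e = U ((edgePerm σ).symm e) := rfl

variable [Group G] (ρ : G →* Matrix.unitaryGroup (Fin N) ℂ)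

/-- Holonomies of the permuted field. [cite: MontvayMunster1994, §3.2] -/
theorem plaquetteHolonomy_configPermG (σ : Equiv.Perm (Fin ν)) (U : GaugeConfig ν L G) (y : TorusSite ν L) (a b : Fin ν) :
    plaquetteHolonomy (configPermG σ U) y a b = plaquetteHolonomy U (coordPerm σ.symm y) (σ a) (σ b) := by
  simp only [plaquetteHolonomy, configPermG_apply, edgePerm_symm_apply, coordPerm_shift, Equiv.symm_symm]

omit [MeasurableSpace G] in
/-- The plaquette cost of a unitary representation is orientation independent (`Re tr ρ(h⁻¹) = Re tr ρ(h)`). [cite: MontvayMunster1994, §3.2] -/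
theorem plaqCostG_inv (h : G) :
    (N : ℝ) - (StaggeredRP.repMat ρ h⁻¹).trace.re = (N : ℝ) - (StaggeredRP.repMat ρ h).trace.re := by
  rw [StaggeredRP.repMat_apply, StaggeredRP.repMat_apply, map_inv, Matrix.UnitaryGroup.inv_val,
    Matrix.star_eq_conjTranspose, Matrix.trace_conjTranspose, Complex.star_def, Complex.conj_re]

omit [MeasurableSpace G] in
/-- The Wilson action as half the sum over ordered pairs of distinct directions. [cite: MontvayMunster1994, §3.2] -/
theorem wilsonActionG_eq_half_sum [NeZero L] (U : GaugeConfig ν L G) :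
    wilsonAction (StaggeredRP.repMat ρ) U =
      (1 / 2 : ℝ) * ∑ x : TorusSite ν L, ∑ a : Fin ν, ∑ b : Fin ν,
        if a = b then 0 else ((N : ℝ) - (StaggeredRP.repMat ρ (plaquetteHolonomy U x a b)).trace.re) := by
  classical
  set F : TorusSite ν L → Fin ν → Fin ν → ℝ :=
    fun x a b => (N : ℝ) - (StaggeredRP.repMat ρ (plaquetteHolonomy U x a b)).trace.re with hF
  have hsym : ∀ x a b, F x b a = F x a b := fun x a b => by
    simp only [hF, plaquetteHolonomy_swap U x a b, plaqCostG_inv]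
  have hP : wilsonAction (StaggeredRP.repMat ρ) U =
      ∑ x : TorusSite ν L, ∑ p : {p : Fin ν × Fin ν // p.1 < p.2}, F x p.1.1 p.1.2 := by
    rw [wilsonAction, Fintype.sum_prod_type]
  rw [hP, Finset.mul_sum]
  refine Finset.sum_congr rfl fun x _ => ?_
  have hlt : ∑ p : {p : Fin ν × Fin ν // p.1 < p.2}, F x p.1.1 p.1.2 =
      ∑ p ∈ (Finset.univ : Finset (Fin ν × Fin ν)).filter (fun p => p.1 < p.2), F x p.1 p.2 := by
    exact (Finset.sum_subtype _ (fun p => by simp) (fun p : Fin ν × Fin ν => F x p.1 p.2)).symm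
  have hgt : ∑ p ∈ (Finset.univ : Finset (Fin ν × Fin ν)).filter (fun p => p.2 < p.1), F x p.1 p.2 =
      ∑ p ∈ (Finset.univ : Finset (Fin ν × Fin ν)).filter (fun p => p.1 < p.2), F x p.1 p.2 := by
    refine Finset.sum_nbij' Prod.swap Prod.swap (fun p hp => ?_) (fun p hp => ?_) (fun _ _ => rfl) (fun _ _ => rfl)
      (fun p _ => hsym x p.2 p.1)
    · simp only [Finset.mem_filter, Finset.mem_univ, true_and] at hp ⊢; exact hp
    · simp only [Finset.mem_filter, Finset.mem_univ, true_and] at hp ⊢; exact hp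
  have hne : ∑ a : Fin ν, ∑ b : Fin ν, (if a = b then 0 else F x a b) =
      ∑ p ∈ (Finset.univ : Finset (Fin ν × Fin ν)).filter (fun p => p.1 < p.2), F x p.1 p.2 +
        ∑ p ∈ (Finset.univ : Finset (Fin ν × Fin ν)).filter (fun p => p.2 < p.1), F x p.1 p.2 := by
    rw [← Finset.sum_product' (f := fun a b => if a = b then (0 : ℝ) else F x a b), Finset.univ_product_univ,
      ← Finset.sum_filter_add_sum_filter_not Finset.univ (fun p : Fin ν × Fin ν => p.1 < p.2)]
    congr 1
    · exact Finset.sum_congr rfl fun p hp => by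
        rw [Finset.mem_filter] at hp; rw [if_neg (ne_of_lt hp.2)]
    · rw [← Finset.sum_filter_add_sum_filter_not ((Finset.univ : Finset (Fin ν × Fin ν)).filter fun p => ¬ p.1 < p.2)
        (fun p : Fin ν × Fin ν => p.2 < p.1), Finset.filter_filter, Finset.filter_filter]
      have h1 : (Finset.univ : Finset (Fin ν × Fin ν)).filter (fun p => ¬ p.1 < p.2 ∧ p.2 < p.1) =
          Finset.univ.filter (fun p => p.2 < p.1) := by
        ext p; simp only [Finset.mem_filter, Finset.mem_univ, true_and]; constructor
        · exact fun h => h.2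
        · exact fun h => ⟨not_lt.2 h.le, h⟩
      have h2 : ∑ p ∈ (Finset.univ : Finset (Fin ν × Fin ν)).filter (fun p => ¬ p.1 < p.2 ∧ ¬ p.2 < p.1),
          (if p.1 = p.2 then (0 : ℝ) else F x p.1 p.2) = 0 :=
        Finset.sum_eq_zero fun p hp => by
          rw [Finset.mem_filter] at hp
          rw [if_pos (le_antisymm (not_lt.1 hp.2.2) (not_lt.1 hp.2.1))]
      rw [h1, h2, add_zero]
      exact Finset.sum_congr rfl fun p hp => by
        rw [Finset.mem_filter] at hp; rw [if_neg (ne_of_gt hp.2)]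
  rw [hne, hgt, hlt]
  ring

/-- **The Wilson action of a unitary representation is invariant under coordinate permutations.** [cite: MontvayMunster1994, §3.2] -/
theorem wilsonActionG_configPerm [NeZero L] (σ : Equiv.Perm (Fin ν)) (U : GaugeConfig ν L G) :
    wilsonAction (StaggeredRP.repMat ρ) (configPermG σ U) = wilsonAction (StaggeredRP.repMat ρ) U := by
  rw [wilsonActionG_eq_half_sum, wilsonActionG_eq_half_sum]
  refine congrArg (fun t : ℝ => (1 / 2 : ℝ) * t) ?_
  simp only [plaquetteHolonomy_configPermG]
  exact (Finset.sum_congr rfl fun y _ => sum_pairs_perm σ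
      (fun a b => (N : ℝ) - (StaggeredRP.repMat ρ (plaquetteHolonomy U (coordPerm σ.symm y) a b)).trace.re)).trans
    (Equiv.sum_comp (coordPerm (L := L) σ.symm) fun x => ∑ a : Fin ν, ∑ b : Fin ν,
      if a = b then (0 : ℝ) else ((N : ℝ) - (StaggeredRP.repMat ρ (plaquetteHolonomy U x a b)).trace.re))

end GaugePerm

variable {N ν L : ℕ} [NeZero ν] [NeZero L] [LinearOrder (TorusSite ν L)]

omit [LinearOrder (TorusSite ν L)] [NeZero ν] in
/-- The `SU(N)` plaquette factor is invariant under coordinate permutations. [cite: SalmhoferSeiler1991, §2 (2.2)] -/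
theorem plaqSU_configPerm (β : ℝ) (σ : Equiv.Perm (Fin ν)) (V : GaugeConfig ν L (OneLink.SUN N)) :
    plaqSU N ν L β (configPermG σ V) = plaqSU N ν L β V := by
  rw [plaqSU, plaqSU, wilsonActionG_configPerm]

omit [LinearOrder (TorusSite ν L)] [NeZero ν] in
/-- The `SU(N)` plaquette factor is translation invariant. [cite: SalmhoferSeiler1991, §2 (2.2)] -/
theorem plaqSU_torusConfigShift (β : ℝ) (c : TorusSite ν L) (V : GaugeConfig ν L (OneLink.SUN N)) :
    plaqSU N ν L β (torusConfigShift c V) = plaqSU N ν L β V := by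
  rw [plaqSU, plaqSU, wilsonAction_torusConfigShift]

/-! ### `J_β(ρG) = det ρ · J_β(G)` for compatible relabellings preserving the plaquette weight -/

/-- **`J_β(ρ_{g,s} G) = det ρ_{g,s} · J_β(G)`** for a relabelling compatible with the links and the all-antiperiodic
signs whose link permutation preserves the plaquette weight. [cite: SalmhoferSeiler1991, §2 (2.9)–(2.12)] [cite: Berezin1966, Ch. I §3] -/
theorem suJB_siteRelabel (β : ℝ) (g : TorusSite ν L ≃ TorusSite ν L) (s : TorusSite ν L → ℂ)
    (π : (TorusSite ν L × Fin ν) ≃ (TorusSite ν L × Fin ν))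
    (hl : ∀ b, torusLinks ν L (π b) = (g (torusLinks ν L b).1, g (torusLinks ν L b).2))
    (hΓ : ∀ b, apSigns ν L (π b) = s (torusLinks ν L b).1 * s (torusLinks ν L b).2 * apSigns ν L b)
    (hplaq : ∀ V, plaqSU N ν L β (MeasurableEquiv.arrowCongr' π (MeasurableEquiv.refl (OneLink.SUN N)) V) = plaqSU N ν L β V)
    (G : FermiAlg (TorusSite ν L) N) :
    suJB N ν L β (siteRelabel N g s G) = LinearMap.det (siteSubst (N := N) g s) * suJB N ν L β G := by
  have hfB : ∀ V : TorusSite ν L × Fin ν → OneLink.SUN N,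
      siteRelabel N g s (fermiBoltzmannSU (torusLinks ν L) (apSigns ν L) 0 V) =
        fermiBoltzmannSU (torusLinks ν L) (apSigns ν L) 0
          (MeasurableEquiv.arrowCongr' π (MeasurableEquiv.refl (OneLink.SUN N)) V) := fun V => by
    rw [fermiBoltzmannSU_eq_grassmannExp, fermiBoltzmannSU_eq_grassmannExp, map_grassmannExp_eq]
    unfold negActionSU
    rw [siteRelabel_negAction_zero g s _ _ π hl hΓ]
    rfl
  rw [suJB, suJB, ← integral_const_mul,
    ← (measurePreserving_arrowCongr_SU (N := N) π).integral_comp (MeasurableEquiv.measurableEmbedding _)]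
  refine integral_congr_ae (ae_of_all _ fun V => ?_)
  dsimp only
  rw [hplaq, ← hfB, ← map_mul, berezin_siteRelabel]
  ring

/-- `det ρ_{g,s} = 1` whenever `Z_β ≠ 0` for some `β` at which `ρ` is compatible. [cite: Berezin1966, Ch. I §3] -/
theorem det_siteSubst_eq_one_of_ne_zero {β : ℝ} (hZ : suJB N ν L β 1 ≠ 0)
    (g : TorusSite ν L ≃ TorusSite ν L) (s : TorusSite ν L → ℂ) (π : (TorusSite ν L × Fin ν) ≃ (TorusSite ν L × Fin ν))
    (hl : ∀ b, torusLinks ν L (π b) = (g (torusLinks ν L b).1, g (torusLinks ν L b).2))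
    (hΓ : ∀ b, apSigns ν L (π b) = s (torusLinks ν L b).1 * s (torusLinks ν L b).2 * apSigns ν L b)
    (hplaq : ∀ V, plaqSU N ν L β (MeasurableEquiv.arrowCongr' π (MeasurableEquiv.refl (OneLink.SUN N)) V) = plaqSU N ν L β V) :
    LinearMap.det (siteSubst (N := N) g s) = 1 := by
  have h := suJB_siteRelabel β g s π hl hΓ hplaq (1 : FermiAlg (TorusSite ν L) N)
  rw [map_one] at h
  exact (mul_eq_right₀ hZ).1 h.symm

/-- **The `β`-dressed moments are invariant under every compatible relabelling** (`s² = 1`, `Z_β ≠ 0`). [cite: SalmhoferSeiler1991, (3.100); MontvayMunster1994, §4.3] -/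
theorem mesonMomentSUB_mapDomain_of_relabel {β : ℝ} (hZ : suJB N ν L β 1 ≠ 0)
    (g : TorusSite ν L ≃ TorusSite ν L) (s : TorusSite ν L → ℂ) (π : (TorusSite ν L × Fin ν) ≃ (TorusSite ν L × Fin ν))
    (hl : ∀ b, torusLinks ν L (π b) = (g (torusLinks ν L b).1, g (torusLinks ν L b).2))
    (hΓ : ∀ b, apSigns ν L (π b) = s (torusLinks ν L b).1 * s (torusLinks ν L b).2 * apSigns ν L b)
    (hplaq : ∀ V, plaqSU N ν L β (MeasurableEquiv.arrowCongr' π (MeasurableEquiv.refl (OneLink.SUN N)) V) = plaqSU N ν L β V)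
    (hs : ∀ x, s x * s x = 1) (m : TorusSite ν L →₀ ℕ) :
    mesonMomentSUB N ν L β (Finsupp.mapDomain g m) = mesonMomentSUB N ν L β m := by
  rw [mesonMomentSUB, mesonMomentSUB, ← rename_monomial, ← siteRelabel_bos g hs,
    suJB_siteRelabel β g s π hl hΓ hplaq, det_siteSubst_eq_one_of_ne_zero hZ g s π hl hΓ hplaq, one_mul]

/-! ### Translations and axis transpositions at `β` -/

/-- The unit translations preserve the moments at `β`. [cite: SalmhoferSeiler1991, (3.100); MontvayMunster1994, §4.3] -/
theorem mesonMomentSUB_mapDomain_addRight_single (hL : Even L) {β : ℝ} (hZ : suJB N ν L β 1 ≠ 0) (j : Fin ν)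
    (m : TorusSite ν L →₀ ℕ) :
    mesonMomentSUB N ν L β (Finsupp.mapDomain (Equiv.addRight (Pi.single j (1 : ZMod L))) m) = mesonMomentSUB N ν L β m :=
  mesonMomentSUB_mapDomain_of_relabel hZ _ (transSign j) (torusEdgeShift (Pi.single j 1))
    (torusLinks_torusEdgeShift _) (apSigns_translate hL j) (fun V => plaqSU_torusConfigShift β _ V) (transSign_mul_self j) m

/-- **THE `β`-DRESSED MOMENTS ARE TRANSLATION INVARIANT** (`Z_β ≠ 0`). [cite: SalmhoferSeiler1991, (3.100); MontvayMunster1994, §4.3] -/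
theorem mesonMomentSUB_mapDomain_addRight (hL : Even L) {β : ℝ} (hZ : suJB N ν L β 1 ≠ 0) (c : TorusSite ν L)
    (m : TorusSite ν L →₀ ℕ) :
    mesonMomentSUB N ν L β (Finsupp.mapDomain (Equiv.addRight c) m) = mesonMomentSUB N ν L β m := by
  have hadd : ∀ a b : TorusSite ν L,
      (∀ m, mesonMomentSUB N ν L β (Finsupp.mapDomain (Equiv.addRight a) m) = mesonMomentSUB N ν L β m) →
      (∀ m, mesonMomentSUB N ν L β (Finsupp.mapDomain (Equiv.addRight b) m) = mesonMomentSUB N ν L β m) →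
      ∀ m, mesonMomentSUB N ν L β (Finsupp.mapDomain (Equiv.addRight (a + b)) m) = mesonMomentSUB N ν L β m := by
    intro a b ha hb m
    rw [show (⇑(Equiv.addRight (a + b)) : TorusSite ν L → TorusSite ν L) = ⇑(Equiv.addRight b) ∘ ⇑(Equiv.addRight a) from
      funext fun x => (add_assoc x a b).symm, Finsupp.mapDomain_comp, hb, ha]
  have hzero : ∀ m, mesonMomentSUB N ν L β (Finsupp.mapDomain (Equiv.addRight (0 : TorusSite ν L)) m) = mesonMomentSUB N ν L β m :=
    fun m => by rw [Equiv.addRight_zero, Equiv.Perm.coe_one, Finsupp.mapDomain_id]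
  have hnsmul : ∀ (j : Fin ν) (n : ℕ) (m : TorusSite ν L →₀ ℕ),
      mesonMomentSUB N ν L β (Finsupp.mapDomain (Equiv.addRight (n • (Pi.single j (1 : ZMod L) : TorusSite ν L))) m) =
        mesonMomentSUB N ν L β m := by
    intro j n
    induction n with
    | zero => rw [zero_smul]; exact hzero
    | succ n ih => rw [succ_nsmul]; exact hadd _ _ ih (mesonMomentSUB_mapDomain_addRight_single hL hZ j)
  have hc : c = ∑ j, (c j).val • (Pi.single j (1 : ZMod L) : TorusSite ν L) := by
    funext i
    simp only [Finset.sum_apply, Pi.smul_apply, Pi.single_apply, smul_ite, smul_zero, Finset.sum_ite_eq,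
      Finset.mem_univ, if_true, nsmul_one, ZMod.natCast_zmod_val]
  rw [hc]
  have key : ∀ s : Finset (Fin ν), ∀ m,
      mesonMomentSUB N ν L β (Finsupp.mapDomain (Equiv.addRight (∑ j ∈ s, (c j).val • (Pi.single j (1 : ZMod L) : TorusSite ν L))) m) =
        mesonMomentSUB N ν L β m := by
    intro s
    classical
    induction s using Finset.induction_on with
    | empty => rw [Finset.sum_empty]; exact hzero
    | insert j s hj ih => rw [Finset.sum_insert hj]; exact hadd _ _ (hnsmul j _) ih
  exact key _ m

/-- The adjacent transpositions preserve the moments at `β`. [cite: MontvayMunster1994, §4.3] -/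
theorem mesonMomentSUB_mapDomain_adjSwap (hL : Even L) {β : ℝ} (hZ : suJB N ν L β 1 ≠ 0) {j k : Fin ν}
    (hjk : (k : ℕ) = j + 1) (m : TorusSite ν L →₀ ℕ) :
    mesonMomentSUB N ν L β (Finsupp.mapDomain (coordPerm (Equiv.swap j k)) m) = mesonMomentSUB N ν L β m :=
  mesonMomentSUB_mapDomain_of_relabel hZ _ (swapSign j k) (edgePerm (Equiv.swap j k)) (torusLinks_edgePerm _)
    (apSigns_edgePerm_swap hL hjk) (fun V => plaqSU_configPerm β _ V) (swapSign_mul_self j k) m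

/-- Every permutation of the axes preserves the moments at `β`. [cite: MontvayMunster1994, §4.3] -/
theorem mesonMomentSUB_mapDomain_coordPerm (hL : Even L) {β : ℝ} (hZ : suJB N ν L β 1 ≠ 0) (σ : Equiv.Perm (Fin ν))
    (m : TorusSite ν L →₀ ℕ) :
    mesonMomentSUB N ν L β (Finsupp.mapDomain (coordPerm σ) m) = mesonMomentSUB N ν L β m := by
  obtain ⟨n, hn⟩ := Nat.exists_eq_succ_of_ne_zero (NeZero.ne ν)
  subst hn
  have hσ : σ ∈ Submonoid.closure (Set.range fun i : Fin n => Equiv.swap i.castSucc i.succ) := by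
    rw [Equiv.Perm.mclosure_swap_castSucc_succ]; exact Submonoid.mem_top σ
  revert m
  refine Submonoid.closure_induction (fun τ hτ => ?_) (fun m => ?_) (fun τ τ' _ _ hτ hτ' m => ?_) hσ
  · obtain ⟨i, rfl⟩ := hτ
    exact fun m => mesonMomentSUB_mapDomain_adjSwap hL hZ (by simp [Fin.val_succ]) m
  · rw [show (⇑(coordPerm (L := L) (1 : Equiv.Perm (Fin (n + 1)))) : TorusSite (n + 1) L → TorusSite (n + 1) L) = id
      from funext fun x => funext fun l => rfl, Finsupp.mapDomain_id]
  · rw [show (⇑(coordPerm (L := L) (τ * τ')) : TorusSite (n + 1) L → TorusSite (n + 1) L) =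
        ⇑(coordPerm (L := L) τ') ∘ ⇑(coordPerm (L := L) τ) from funext fun x => funext fun l => rfl,
      Finsupp.mapDomain_comp, hτ', hτ]

/-- **THE `β`-DRESSED MOMENTS ARE INVARIANT UNDER THE AXIS TRANSPOSITIONS** (`Z_β ≠ 0`). [cite: MontvayMunster1994, §4.3] -/
theorem mesonMomentSUB_mapDomain_axisSwap (hL : Even L) {β : ℝ} (hZ : suJB N ν L β 1 ≠ 0) (i : Fin ν)
    (m : TorusSite ν L →₀ ℕ) :
    mesonMomentSUB N ν L β (Finsupp.mapDomain (axisSwap i) m) = mesonMomentSUB N ν L β m := by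
  rw [show (⇑(axisSwap (L := L) i) : TorusSite ν L → TorusSite ν L) = ⇑(coordPerm (L := L) (Equiv.swap 0 i))
    from funext fun x => rfl]
  exact mesonMomentSUB_mapDomain_coordPerm hL hZ _ m

/-! ### The chiral grading at `β` -/

/-- **`J_β(ψ̄ψ(x)ψ̄ψ(y)) = 0` for `x, y` of equal parity** (the `m = 0` selection rule at every gauge field,
integrated against the Wilson weight). [cite: SalmhoferSeiler1991, (3.101) and (3.106)] -/
theorem suJB_meson_meson_eq_zero (hL : Even L) (β : ℝ) {x y : TorusSite ν L}
    (hxy : ComplexSpin.sgn hL.two_dvd x = ComplexSpin.sgn hL.two_dvd y) :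
    suJB N ν L β (meson x * meson y) = 0 := by
  set ε : TorusSite ν L → ℂ := fun z => ((ComplexSpin.sgn hL.two_dvd z : ℤ) : ℂ) with hε
  have hε0 : ∑ z, ε z = 0 := by
    show ∑ z, ((ComplexSpin.sgn hL.two_dvd z : ℤ) : ℂ) = 0
    exact_mod_cast ComplexSpin.sum_sgn_eq_zero (ν := ν) hL.two_dvd NeZero.one_le
  have hl : ∀ b, ε (torusLinks ν L b).1 + ε (torusLinks ν L b).2 = 0 := fun b => by
    simp only [hε, torusLinks, ComplexSpin.sgn_add_single]
    push_cast; ring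
  have hxy' : ε x + ε y ≠ 0 := by
    simp only [hε, hxy]
    unfold ComplexSpin.sgn; split_ifs <;> norm_num
  rw [suJB]
  simp_rw [fermiBoltzmannSU, berezin_meson_meson_fermiBoltzmann_massZero hε0 _ hl _ _ hxy', mul_zero]
  exact integral_zero _ _

/-- **The chiral grading at `β`**: `T_β(x, y) = 0` for `x, y` of equal parity. [cite: SalmhoferSeiler1991, (3.101) and (3.106)] -/
theorem suTwoPointB_eq_zero_of_sgn_eq (hL : Even L) (β : ℝ) {x y : TorusSite ν L}
    (hxy : ComplexSpin.sgn hL.two_dvd x = ComplexSpin.sgn hL.two_dvd y) : suTwoPointB N ν L β x y = 0 := by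
  rw [suTwoPointB, suJB_meson_meson_eq_zero hL β hxy, zero_div, Complex.zero_re]

end MesonWeightSU

end Summit.Ventures.YMGap.Conjectures

end
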